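import Summits.ResolutionOfSingularities.ResolutionOfSingularities.Theorems.HilbertSamuelEliminationSigmaMaxModificationsCorridor3WLadderIsoTailsEmbeddedStepStalk
import Mathlib.RingTheory.Localization.Ideal
import HarnessLib

/-!
# [OURS · L1 W4.2] D14 K1, ROUTE G v2 «ARC LIMIT», object **G2a — IDEAL STRICT TRANSFORMS**, part 1: the embedded local step for an
# ARBITRARY kernel (no hypersurface hypothesis): `𝒪_{X′,x′} ≅ R[𝔪/c_j]_𝔔 ⧸ sat_{c_j}(K·R[𝔪/c_j])_𝔔`
# (crux chain w42, line `w_ladder` v8.3, kernel K1 `IsoFreeRationalTailsImpossible` in every embedding dimension;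
# `--supports stmt-ResolutionOfSingularities-19249`, helper)

OURS (cell `res-hironaka`, slot ★L-G4 W4.2, hand res-type-071 per res-L1-w42-plan-1 RULING v3.14-20 (FO) «G2a ideal strict transforms :=
071»; spec = res-L1-w42-lead-1's `ROUTE-G-ARCLIMIT.md` sha16 `96c77a196e17bc23` §4 G2a «non-principal kernels:
`ker σ_{n+1} = sat_t(ι(ker σ_n)·R_{n+1})` … ONLY `⊇` + `(J_{n+1} : X 0) = J_{n+1}` are consumed»). NOT a statement of H. Hironaka's
manuscript [Hironaka2017] (under review in the cell, unused here) nor of [CossartJannsenSaito2020]; AI-written, weaker than expert review.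
Sorry-free PROOF file: no definitions, no named facts. Generalises `EmbeddedStep.exists_stalk_presentation` (p523071, hypersurface case).

* `exists_localization_map_of_surjective_ker` — exactness of localisation along a surjection, general kernel (Mathlib `IsLocalization.ker_map`).
* `exists_stalk_presentation_ideal` — for a blow-up `π : X′ → X` along `D` with `D_x = 𝔪_x`, `x′` over `x`, and ANY surjection
  `σ : R ↠ 𝒪_{X,x}` from a regular local ring with r.s.p. `c` (kernel `K = ker σ` arbitrary — `Spec 𝒪_{X,x} ↪ Spec R` any closed
  subscheme of any codimension): there are a chart `j`, a prime `𝔔` of `B = R[𝔪/c_j]` over `𝔪_R` and a SURJECTION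
  `σ′ : R′ = B_𝔔 ↠ 𝒪_{X′,x′}` extending `π♯ ∘ σ`, with `R′` a regular local ring, and the kernel described by the three clauses the
  arc-limit argument consumes: **(⊇)** `K·R′ ⊆ ker σ′`; **(sat)** `(c_j/1)·g ∈ ker σ′ ⇒ g ∈ ker σ′`; **(exact)**
  `g ∈ ker σ′ ⇒ ∃ N, (c_j/1)^N·g ∈ K·R′` — i.e. `ker σ′ = sat_{c_j}(K·R′)`, the STRICT TRANSFORM of the ideal `K` on the chart
  (GW 13.96 (2): `Bl_{𝔪}(Spec R/K) ↪ Bl_𝔪(Spec R)` is cut out on `D₊(c_j t)` by the `c_j`-saturation of `K·R[𝔪/c_j]`, tree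
  `mem_ker_blowupAlgebraMap_iff`); plus `σ′((c_k/c_j)/1)·π♯σ(c_j) = π♯σ(c_k)`, `π♯σ(c_j)` a non-zero-divisor generating `𝓘(E)_{x′}`.
* `exists_stalk_presentation_ideal_of_eq`, `exists_stalk_presentation_ideal_tower` — base point named / along a Literature `BlowupTower`.

## References
* U. Görtz, T. Wedhorn, *Algebraic Geometry I*, 2nd ed. (2020), (13.19), Prop. 13.91, Prop. 13.96 (2) and p. 416. [GortzWedhorn2020]
* The Stacks Project, Tags 0804, 07Z3, 080E. [StacksProject]
* V. Cossart, U. Jannsen, S. Saito, LNM 2270 (2020), Def. 6.34 (6.25). [CossartJannsenSaito2020]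
-/

noncomputable section

-- the mandated cell namespace `Summit.ResolutionOfSingularities.ResolutionOfSingularities.…` re-enters the summit name
set_option linter.dupNamespace false

open CategoryTheory AlgebraicGeometry TopologicalSpace IsLocalRing
open Literature.AlgebraicGeometry.Resolution

namespace Summit.ResolutionOfSingularities.ResolutionOfSingularities.Cruxes.SigmaMaxModifications.IdeasL1C5.EmbeddedStep

universe u

/-! ## Exactness of localisation along a surjection (general kernel) -/

/-- For a surjective ring map `ψ : B ↠ B′`, a prime `𝔔′` of `B′` and a localisation `L′` of `B′` at `𝔔′`, the induced map
`B_{ψ⁻¹𝔔′} → L′` is surjective with kernel `(ker ψ)·B_{ψ⁻¹𝔔′}` and sends `b/1 ↦ ψ(b)/1`. (Mathlib `IsLocalization.map`, `ker_map`.)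
[folklore] -/
theorem exists_localization_map_of_surjective_ker {B B' : Type u} [CommRing B] [CommRing B'] (L' : Type u)
    [CommRing L'] [Algebra B' L'] (ψ : B →+* B') (hψ : Function.Surjective ψ) (𝔔' : Ideal B') [𝔔'.IsPrime]
    [IsLocalization.AtPrime L' 𝔔'] :
    ∃ τ : Localization.AtPrime (𝔔'.comap ψ) →+* L',
      Function.Surjective τ ∧
      RingHom.ker τ = (RingHom.ker ψ).map (algebraMap B (Localization.AtPrime (𝔔'.comap ψ))) ∧
      ∀ b, τ (algebraMap B _ b) = algebraMap B' L' (ψ b) := by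
  have hT : Submonoid.map ψ (𝔔'.comap ψ).primeCompl = 𝔔'.primeCompl := by
    ext y
    constructor
    · rintro ⟨b, hb, rfl⟩
      exact hb
    · intro hy
      obtain ⟨b, rfl⟩ := hψ y
      exact ⟨b, hy, rfl⟩
  refine ⟨IsLocalization.map L' ψ
      (show (𝔔'.comap ψ).primeCompl ≤ 𝔔'.primeCompl.comap ψ from fun b hb => hb), ?_, ?_,
    fun b => IsLocalization.map_eq _ b⟩
  · intro z
    obtain ⟨⟨y, s⟩, hz⟩ := IsLocalization.surj 𝔔'.primeCompl z
    obtain ⟨b, rfl⟩ := hψ y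
    obtain ⟨t, ht⟩ := hψ s.1
    have hts : t ∈ (𝔔'.comap ψ).primeCompl := fun h => s.2 (by rw [← ht]; exact Ideal.mem_comap.mp h)
    refine ⟨IsLocalization.mk' _ b ⟨t, hts⟩, ?_⟩
    rw [IsLocalization.map_mk', IsLocalization.mk'_eq_iff_eq_mul]
    change algebraMap B' L' (ψ b) = z * algebraMap B' L' (ψ t)
    rw [ht]
    exact hz.symm
  · exact IsLocalization.ker_map (S := Localization.AtPrime (𝔔'.comap ψ)) L' ψ hT

/-- **Exactness + saturation bookkeeping, abstract rings** (to keep elaboration light in the stalk proof): for a surjection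
`ψ : B ↠ B′` whose kernel is the `T`-saturation of an ideal `K′` (`k ∈ ker ψ ↔ ∃ n, Tⁿ k ∈ K′` — the shape of the tree's
`mem_ker_blowupAlgebraMap_iff`), a prime `𝔔′` of `B′` and a localisation `L′` of `B′` at `𝔔′`: the induced `τ : B_{ψ⁻¹𝔔′} ↠ L′` is
surjective, `τ(b/1) = ψ(b)/1`, `K′·B_{ψ⁻¹𝔔′} ⊆ ker τ`, and every `g ∈ ker τ` has `(T/1)ⁿ g ∈ K′·B_{ψ⁻¹𝔔′}` for some `n`. [folklore] -/
theorem exists_localization_map_of_surjective_sat {B B' : Type u} [CommRing B] [CommRing B'] (L' : Type u)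
    [CommRing L'] [Algebra B' L'] (ψ : B →+* B') (hψ : Function.Surjective ψ) (K' : Ideal B) (T : B)
    (hker : ∀ k, k ∈ RingHom.ker ψ → ∃ n : ℕ, T ^ n * k ∈ K') (hK' : K' ≤ RingHom.ker ψ)
    (𝔔' : Ideal B') [𝔔'.IsPrime] [IsLocalization.AtPrime L' 𝔔'] :
    ∃ τ : Localization.AtPrime (𝔔'.comap ψ) →+* L',
      Function.Surjective τ ∧
      (∀ b, τ (algebraMap B _ b) = algebraMap B' L' (ψ b)) ∧
      K'.map (algebraMap B (Localization.AtPrime (𝔔'.comap ψ))) ≤ RingHom.ker τ ∧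
      ∀ g, g ∈ RingHom.ker τ → ∃ n : ℕ, algebraMap B (Localization.AtPrime (𝔔'.comap ψ)) T ^ n * g ∈
        K'.map (algebraMap B (Localization.AtPrime (𝔔'.comap ψ))) := by
  obtain ⟨τ, hτs, hτker, hτb⟩ := exists_localization_map_of_surjective_ker L' ψ hψ 𝔔'
  refine ⟨τ, hτs, hτb, ?_, fun g hg => ?_⟩
  · rw [hτker]
    exact Ideal.map_mono hK'
  · rw [hτker] at hg
    obtain ⟨⟨⟨k, hk⟩, ⟨s, hs⟩⟩, hgs⟩ :=
      (IsLocalization.mem_map_algebraMap_iff (𝔔'.comap ψ).primeCompl (Localization.AtPrime (𝔔'.comap ψ))).mp hg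
    obtain ⟨n, hn⟩ := hker k hk
    refine ⟨n, ?_⟩
    have hu : IsUnit (algebraMap B (Localization.AtPrime (𝔔'.comap ψ)) s) := IsLocalization.map_units _ ⟨s, hs⟩
    have hg' : g = algebraMap B _ k * ↑hu.unit⁻¹ := by
      rw [← hgs, mul_assoc, IsUnit.mul_val_inv, mul_one]
    rw [hg', ← mul_assoc, ← map_pow, ← map_mul]
    exact Ideal.mul_mem_right _ _ (Ideal.mem_map_of_mem _ hn)

/-! ## The embedded local step for an arbitrary kernel -/

section Stalk

variable {X X' : Scheme.{u}} {π : X' ⟶ X} {D : X.IdealSheafData}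

set_option maxHeartbeats 800000 in
-- instance unification on the affine blowup algebra of a stalk is slow (as in `BlowupStalkBlowupAlgebra.lean`)
/-- **G2a — THE EMBEDDED LOCAL STEP FOR AN ARBITRARY KERNEL.** Let `π : X′ → X` be a blow-up along `D` with `D_x = 𝔪_x`, `x′` over
`x`, and `σ : R ↠ 𝒪_{X,x}` ANY surjection from a regular local ring `R` with regular system of parameters `c` (kernel `K` arbitrary).
Then for some chart `j` there are a prime `𝔔` of `B = R[𝔪/c_j]` over `𝔪_R` and a surjection `σ′ : R′ = B_𝔔 ↠ 𝒪_{X′,x′}` with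
`σ′(r/1) = π♯σ(r)`, `R′` regular local, kernel `ker σ′ = sat_{c_j}(K·R′)` stated as the three clauses (⊇) / (sat) / (exact),
`σ′((c_k/c_j)/1)·π♯σ(c_j) = π♯σ(c_k)`, `π♯σ(c_j)` a non-zero-divisor, `𝓘(E)_{x′} = (π♯σ(c_j))`.
[cite: GortzWedhorn2020, Prop. 13.91, Prop. 13.96 (2); StacksProject, Tag 0804] -/
theorem exists_stalk_presentation_ideal (hπ : IsBlowup π D) (x' : X')
    (hD : stalkIdeal D (π x') = maximalIdeal (X.presheaf.stalk (π x')))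
    {R : Type u} [CommRing R] [IsRegularLocalRing R] {d : ℕ} (hd : (maximalIdeal R).spanFinrank = d)
    (c : Fin d → R) (hc : Ideal.span (Set.range c) = maximalIdeal R)
    (σ : R →+* X.presheaf.stalk (π x')) (hσ : Function.Surjective σ) :
    ∃ (j : Fin d) (𝔔 : PrimeSpectrum (blowupAlgebra (Ideal.span (Set.range c)) (c j)))
      (σ' : Localization.AtPrime 𝔔.asIdeal →+* X'.presheaf.stalk x'),
      Prime (algebraMap R (blowupAlgebra (Ideal.span (Set.range c)) (c j)) (c j)) ∧
      𝔔.asIdeal.comap (algebraMap R _) = maximalIdeal R ∧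
      IsRegularLocalRing (Localization.AtPrime 𝔔.asIdeal) ∧
      Function.Surjective σ' ∧
      ((RingHom.ker σ).map (algebraMap R (blowupAlgebra (Ideal.span (Set.range c)) (c j)))).map
        (algebraMap _ (Localization.AtPrime 𝔔.asIdeal)) ≤ RingHom.ker σ' ∧
      (∀ g, algebraMap _ (Localization.AtPrime 𝔔.asIdeal)
        (algebraMap R (blowupAlgebra (Ideal.span (Set.range c)) (c j)) (c j)) * g ∈ RingHom.ker σ' → g ∈ RingHom.ker σ') ∧
      (∀ g, g ∈ RingHom.ker σ' → ∃ N : ℕ, algebraMap _ (Localization.AtPrime 𝔔.asIdeal)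
        (algebraMap R (blowupAlgebra (Ideal.span (Set.range c)) (c j)) (c j)) ^ N * g ∈
          ((RingHom.ker σ).map (algebraMap R (blowupAlgebra (Ideal.span (Set.range c)) (c j)))).map
            (algebraMap _ (Localization.AtPrime 𝔔.asIdeal))) ∧
      (∀ r : R, σ' (algebraMap _ (Localization.AtPrime 𝔔.asIdeal)
        (algebraMap R (blowupAlgebra (Ideal.span (Set.range c)) (c j)) r)) = (π.stalkMap x').hom (σ r)) ∧
      (∀ k : Fin d, σ' (algebraMap _ (Localization.AtPrime 𝔔.asIdeal) (blowupAlgebra.frac c j k)) *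
        (π.stalkMap x').hom (σ (c j)) = (π.stalkMap x').hom (σ (c k))) ∧
      (π.stalkMap x').hom (σ (c j)) ∈ nonZeroDivisors (X'.presheaf.stalk x') ∧
      stalkIdeal (D.comap π) x' = Ideal.span {(π.stalkMap x').hom (σ (c j))} := by
  classical
  haveI : IsLocalHom σ := IsLocalHom.of_surjective σ hσ
  have hIJ : (Ideal.span (Set.range c)).map σ = Ideal.span (Set.range fun i => σ (c i)) := by
    rw [Ideal.map_span, ← Set.range_comp]
    rfl
  have hcA : Ideal.span (Set.range fun i => σ (c i)) = stalkIdeal D (π x') := by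
    rw [← hIJ, hc, IsLocalRing.map_maximalIdeal_of_surjective σ hσ, hD]
  obtain ⟨j, 𝔔A, χ, -, hχ, hloc, -, h𝔔A⟩ :
      ∃ (j : Fin d) (𝔔A : PrimeSpectrum (blowupAlgebra (Ideal.span (Set.range fun i => σ (c i))) (σ (c j))))
        (χ : blowupAlgebra (Ideal.span (Set.range fun i => σ (c i))) (σ (c j)) →+* X'.presheaf.stalk x')
        (_ : X'.presheaf.stalk x' ≃+* Localization.AtPrime 𝔔A.asIdeal),
        (∀ a, χ (algebraMap _ _ a) = (π.stalkMap x').hom a) ∧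
        @IsLocalization.AtPrime _ _ (X'.presheaf.stalk x') _ χ.toAlgebra 𝔔A.asIdeal _ ∧ True ∧
        𝔔A.asIdeal.comap (algebraMap _ (blowupAlgebra (Ideal.span (Set.range fun i => σ (c i))) (σ (c j)))) =
          maximalIdeal (X.presheaf.stalk (π x')) := by
    obtain ⟨j, 𝔔A, χ, e, hχ, hloc, -, h𝔔A⟩ :=
      hπ.exists_blowupAlgebra_stalk_ringEquiv x' (fun i => σ (c i)) hcA
    exact ⟨j, 𝔔A, χ, e, hχ, hloc, trivial, h𝔔A⟩
  -- the surjection `ψ : R[𝔪/c_j] ↠ 𝒪_{X,x}[𝔪_x/σ(c_j)]` and its kernel `sat_{c_j}(K·R[𝔪/c_j])`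
  have hJI : Ideal.span (Set.range fun i => σ (c i)) ≤ (Ideal.span (Set.range c)).map σ := hIJ.ge
  have hψsurj := blowupAlgebraMap_surjective σ (Ideal.span (Set.range c)) (Ideal.span (Set.range fun i => σ (c i)))
    (c j) hσ hIJ.le hJI
  letI : Algebra (blowupAlgebra (Ideal.span (Set.range fun i => σ (c i))) (σ (c j))) (X'.presheaf.stalk x') :=
    χ.toAlgebra
  haveI : IsLocalization.AtPrime (X'.presheaf.stalk x') 𝔔A.asIdeal := hloc
  have hKle : (RingHom.ker σ).map (algebraMap R (blowupAlgebra (Ideal.span (Set.range c)) (c j))) ≤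
      RingHom.ker (blowupAlgebraMap σ (Ideal.span (Set.range c)) (Ideal.span (Set.range fun i => σ (c i))) (c j)
        hIJ.le) := by
    rw [Ideal.map_le_iff_le_comap]
    intro r hr
    rw [Ideal.mem_comap, RingHom.mem_ker, blowupAlgebraMap_algebraMap, RingHom.mem_ker.mp hr, map_zero]
  obtain ⟨σ', hσ'surj, hσ'alg, hsub, hexact⟩ := exists_localization_map_of_surjective_sat (X'.presheaf.stalk x')
    (blowupAlgebraMap σ (Ideal.span (Set.range c)) (Ideal.span (Set.range fun i => σ (c i))) (c j) hIJ.le)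
    hψsurj ((RingHom.ker σ).map (algebraMap R _)) (algebraMap R _ (c j))
    (fun k hk => (mem_ker_blowupAlgebraMap_iff σ (Ideal.span (Set.range c))
      (Ideal.span (Set.range fun i => σ (c i))) (c j) hIJ.le k).mp hk) hKle 𝔔A.asIdeal
  have hχalg : ∀ b, algebraMap _ (X'.presheaf.stalk x') b = χ b := fun b => rfl
  have hprime := prime_algebraMap_rsop hd c hc j
  -- compatibility with `π♯ ∘ σ`
  have hcompat : ∀ r : R, σ' (algebraMap _ (Localization.AtPrime (𝔔A.asIdeal.comap
      (blowupAlgebraMap σ (Ideal.span (Set.range c)) (Ideal.span (Set.range fun i => σ (c i))) (c j) hIJ.le)))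
      (algebraMap R (blowupAlgebra (Ideal.span (Set.range c)) (c j)) r)) = (π.stalkMap x').hom (σ r) := by
    intro r
    rw [hσ'alg, hχalg, blowupAlgebraMap_algebraMap]
    exact hχ (σ r)
  have hnzd : (π.stalkMap x').hom (σ (c j)) ∈ nonZeroDivisors (X'.presheaf.stalk x') := by
    rw [← hχ (σ (c j)), ← hχalg]
    exact IsLocalization.nonZeroDivisors_le_comap 𝔔A.asIdeal.primeCompl (X'.presheaf.stalk x')
      algebraMap_mem_nonZeroDivisors_blowupAlgebra
  -- (sat): `c_j/1` is regular modulo `ker σ′` (its image `π♯σ(c_j)` is a non-zero-divisor)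
  have hsat : ∀ g : Localization.AtPrime (𝔔A.asIdeal.comap
      (blowupAlgebraMap σ (Ideal.span (Set.range c)) (Ideal.span (Set.range fun i => σ (c i))) (c j) hIJ.le)),
      σ' (algebraMap _ _ (algebraMap R (blowupAlgebra (Ideal.span (Set.range c)) (c j)) (c j)) * g) = 0 →
        σ' g = 0 := by
    intro g hg
    rw [map_mul, hcompat (c j), mul_comm] at hg
    exact (mul_cancel_right_mem_nonZeroDivisors hnzd).mp (hg.trans (zero_mul _).symm)
  refine ⟨j, ⟨𝔔A.asIdeal.comap _, Ideal.comap_isPrime _ _⟩, σ', hprime, ?_,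
    isRegularLocalRing_localization_rsop hd c hc j _, hσ'surj, hsub, fun g hg => hsat g hg, fun g hg => hexact g hg,
    hcompat, fun k => ?_, hnzd, ?_⟩
  · -- `𝔔 ∩ R = 𝔪_R`
    have e2 := blowupAlgebraMap_comp_algebraMap σ (Ideal.span (Set.range c))
      (Ideal.span (Set.range fun i => σ (c i))) (c j) hIJ.le
    change (𝔔A.asIdeal.comap _).comap _ = _
    rw [Ideal.comap_comap, e2, ← Ideal.comap_comap, h𝔔A]
    exact IsLocalRing.maximalIdeal_comap σ
  · rw [hσ'alg, hχalg, ← hχ (σ (c j)), ← hχ (σ (c k)), ← map_mul,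
      blowupAlgebraMap_gen σ _ _ (c j) hIJ.le (c k) (blowupAlgebra.mem_span_range c k),
      blowupAlgebra.gen_mul_algebraMap]
  · exact (hπ.stalkIdeal_controlledTransform_eq_map_of_isLocalization x' (fun i => σ (c i)) hcA j 𝔔A χ hχ
      hloc).1

end Stalk

end Summit.ResolutionOfSingularities.ResolutionOfSingularities.Cruxes.SigmaMaxModifications.IdeasL1C5.EmbeddedStep

end
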